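import Literature.AlgebraicGeometry.Resolution.WeightedCentreLemmaXL
import Literature.AlgebraicGeometry.Resolution.WeightedCentreIRigid
import HarnessLib

/-!
# LEMMA XL under the class pin condition `(P)_class` — the "F★ normal form" step (instrument, NOT a resolution theorem)

Engine 1 of the RESOLUTION OBSERVATORY toy model `W(f)` (weighted-centre invariant in characteristic `p`) proves its
THEOREM F ("a pinned graded isotropy of the weighted centre which is the identity modulo `σ` is the identity") a second time
through LEMMA XL (`WeightedCentreLemmaXL.exists_normalForm`: pin ⇒ normal form), stated there under the hypothesis (K)
"the constant class pin map `T ↦ Σ_j T_j ∂_j P` is injective on `P := killLight (c ≤ w ·) g`".  `WeightedCentreIRigid`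
discharges (K) from the repaired formal pin condition `(P)_class` (`InvariantDirection.ClassPinned`) under the weight bound
`μ < p · c` (LEMMA K).  This file is the one-line join:

* `LemmaXL.exists_normalForm_of_classPinned` — for a graded endomorphism `Φ` of `k[ε][σ]`, the identity modulo `σ` on
  constants, fixing the slots heavier than `c` and fixing `C g`, with `P = killLight (c ≤ w ·) g` `w`-homogeneous of weight
  `μ < p·c` and class-pinned at every class slot: `Φ (C (ε_V − m_V)) = C (ε_V − m_V)` for suitable LIGHT `m_V` of weight `c`,
  for every class slot `V` (the "F★ normal form").  (`P`'s homogeneity follows from `g`'s by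
  `MvPolynomial.IsWeightedHomogeneous.killLight` of `WeightedCentreTruncation`; it is kept as a hypothesis so that this file
  does not import the truncation calculus.)

Dictionary as in `WeightedCentreLemmaXL` (slots `ε_i = X i` of `k[ε] = MvPolynomial ι k`, exceptional parameter `σ = Polynomial.X`).
References: the graded-isotropy frame [AbramovichTemkinWlodarczyk2024, §5.1, Thm. 5.3.1 (pp. 1575–1578)]; [Lang2002, Ch. IV §1,
Ch. XIII §4].  All statements are OURS (toy-model instruments), not claims of the cited sources.
-/

namespace Literature.AlgebraicGeometry.Resolution.WeightedBlowup

namespace LemmaXL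

open Polynomial InvariantDirection

variable {k : Type*} [Field k] {ι : Type*} [Fintype ι] [DecidableEq ι]

/-- **LEMMA XL under `(P)_class` — the "F★ normal form" step** (ours).  Instrument for the `W(f)` toy model, NOT a resolution
theorem. [cite: AbramovichTemkinWlodarczyk2024, Thm. 5.3.1 (2)–(3) (p. 1578)] -/
theorem exists_normalForm_of_classPinned (p : ℕ) [CharP k p] {w : ι → ℚ} {c ρ μ : ℚ}
    {Φ : (MvPolynomial ι k)[X] →+* (MvPolynomial ι k)[X]} (hΦ : IsGradedHom w ρ Φ) (h0 : ∀ a, (Φ (C a)).coeff 0 = a)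
    (hfix : ∀ i, c < w i → Φ (C (MvPolynomial.X i)) = C (MvPolynomial.X i)) (hw : ∀ i, 0 < w i) (hρ : 0 < ρ)
    (hc : 0 < c) {g : MvPolynomial ι k} (hg : Φ (C g) = C g) (hμ : μ < p * c)
    (hP : MvPolynomial.IsWeightedHomogeneous w (killLight (fun j => c ≤ w j) g) μ)
    (hPin : ∀ V, w V = c → ClassPinned (Finset.univ.filter fun j => w j = c) (killLight (fun j => c ≤ w j) g) V) :
    ∃ m : ι → MvPolynomial ι k, ∀ V, w V = c →
      MvPolynomial.IsWeightedHomogeneous w (m V) c ∧ IsLight w c (m V)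
        ∧ Φ (C (MvPolynomial.X V - m V)) = C (MvPolynomial.X V - m V) :=
  exists_normalForm hΦ h0 hfix hw hρ hc hg
    (eq_zero_of_sum_C_mul_pderiv_eq_zero_of_classPinned p (fun i => (hw i).le) hc hμ hP hPin)

end LemmaXL

end Literature.AlgebraicGeometry.Resolution.WeightedBlowup
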